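import Summits.KontsevichZagierPeriods.KontsevichZagierPeriods.Theorems.LinRedNormalFormWheelThreeSpokesDehomogenise
import Summits.KontsevichZagierPeriods.KontsevichZagierPeriods.Theorems.LinRedNormalFormWheelThreeSpokesLdlChart
import Summits.KontsevichZagierPeriods.KontsevichZagierPeriods.Theorems.LinRedNormalFormWheelThreeSpokesTailChart
import Summits.KontsevichZagierPeriods.KontsevichZagierPeriods.Theorems.LinRedNormalFormWheelThreeSpokesDoubling
import Summits.KontsevichZagierPeriods.KontsevichZagierPeriods.Theorems.LinRedNormalFormWheelThreeSpokesMoebius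
import Summits.KontsevichZagierPeriods.KontsevichZagierPeriods.Theorems.LinRedNormalFormWheelThreeSpokesUnipotentDescent
import Summits.KontsevichZagierPeriods.KontsevichZagierPeriods.Theorems.LinRedNormalFormWheelThreeSpokesDihedralCharts
import Summits.KontsevichZagierPeriods.KontsevichZagierPeriods.Theorems.LinRedNormalFormWheelThreeSpokesSplits
import Summits.KontsevichZagierPeriods.KontsevichZagierPeriods.Theorems.LinRedNormalFormWheelThreeSpokesWordCharts
import Summits.KontsevichZagierPeriods.KontsevichZagierPeriods.Theses.SiegelTamagawa

/-!
# `WheelThreeSpokes` (stmt-KontsevichZagierPeriods-3913, route LinRedNormalForm; shared by route SiegelTamagawa)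

**The first Feynman period inside Conjecture 1.** The wheel with three spokes `K₄` in the affine
chart `α₃₄ = 1`: the rational representation `[ℝ₊⁵, 1/Ψ_{K₄}(x,1)²]` (value `P(K₄) = 6ζ(3)`) is
Kontsevich–Zagier EQUIVALENT — connected by finitely many instances of rules (1) additivity,
(2) change of variables, (3) Newton–Leibniz of [KZ 2001, §1.2], all intermediate data algebraic
(here: rational) and all intermediate integrals absolutely convergent — to the simplex
representation `[1 > t₀ > t₁ > t₂ > 0, 6/(t₀t₁(1−t₂))]` of `6ζ(3)`: `WheelThreeSpokes_of`.

The chain (line `laplacian-ldl-chart` of the crux; LDLᵀ chart of the reduced `K₄` Laplacian, in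
which `Ψ` is the MONOMIAL `d₂d₃`; every intermediate positive, rational, absolutely convergent;
both Newton–Leibniz descents with RATIONAL primitives because the integrand is made free of the
fibre variable first; no regularised limit anywhere):

* `stub_dehomogenise` — `Ψ_typed(x) = det L̃(1,x₄,x₃,x₂,x₁,x₀)`; change of projective section
  (rule 2): `[ℝ₊⁵, 1/Ψ²] ~ [Z5, 1/Ψᴰ(z)²]`;
* `stub_ldlChart` — the LDLᵀ chart (rule 2, polynomial, Jacobian `d₂`): `~ [D5, 1/(d₂d₃²)]`;
* `stub_tailChart` — `d₃ = C/t` (rule 2): `~ [D5T, 1/(d₂C)]`, `C = v(1−u−v) + w(1−w)d₂`;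
* `stub_nlFiveFour` — Newton–Leibniz `5 → 4` along `t` (rule 3): `≡ F4 = [D4, 1/(d₂C)]`;
* `stub_doubling` — the involution `(u,v,w,d₂) ↦ (u,1−u−v,1−w,d₂)` (rules 1a, 2): `≡ 2[P2]`;
* `stub_moebius` — Möbius storage of the logarithm `s = βd₂/(α+βd₂)` (rule 2): `~ [Q, 1/(αs)]`;
* `stub_unipotentDescent` — dissection along `s(u+v) = u` and Newton–Leibniz `4 → 3` along the
  unipotent coordinate `w` twice (rules 1a, 3): `≡ [E] + [F]`;
* `stub_dihedralCharts` — `t = u/(u+v)` (rule 2): `E ~ E_dih`, `F ~ F_dih` on the simplex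
  `1 > t₀ > t₁ > t₂ > 0` (genus-zero dihedral forms);
* `stub_eSplit`, `stub_fSplit` — rule 1b: `E_dih = E₁ − E₂`, `F_dih = ζ(3)`-word `+ ζ(2,1)`-word;
* `stub_wordCharts` — rules 2, 1a: `E₁ ≡ 2·ζ(2,1)`-word, `E₂ ≡ ζ(2,1)`-word;
* duality `ζ(2,1) ~ ζ(3)` (one affine move) and `[Δ₃, 6/(…)] ≡ 6·[Δ₃, 1/(…)]` (rule 1b), from
  `LinRedNormalFormWheelThreeSpokesCharts.lean`.

Bookkeeping: `[r] ≡ 2([E_dih] + [F_dih]) ≡ 2((2−1) + 2)·[ζ(3)-word] = 6·[ζ(3)-word] ≡ [r']`.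
All four hypotheses of the crux are used (identity-shaped congruences at both ends), and both
Newton–Leibniz levels `5 → 4`, `4 → 3` occur, as the standing disproof file requires
(`Cruxes/WheelThreeSpokes/Disproof.lean`, `not_mem_closure_movesAvoidingLevel_four/three`).

References: D. Broadhurst, D. Kreimer (1995); S. Bloch, H. Esnault, D. Kreimer, *On motives
associated to graph polynomials* (2006) (`P(K₄) = 6ζ(3)`); F. Brown, *The massless higher-loop
two-point function* (2009) (linear reducibility of `K₄`); M. Kontsevich, D. Zagier, *Periods*
(2001), §1.2 Conjecture 1.
-/

noncomputable section

open Set MeasureTheory MvPolynomial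
open Literature.NumberTheory.Transcendental
open Literature.ModelTheory.ExponentialFields (IsSemialgebraic)
open Summit.KontsevichZagierPeriods.KontsevichZagierPeriods.Theses.LinRedNormalForm (WheelThreeSpokes)

namespace Summit.KontsevichZagierPeriods.LinRedNormalForm.WheelThreeSpokes

/-- **`WheelThreeSpokes` holds** (item stmt-KontsevichZagierPeriods-3913, `LinRedNormalForm.WheelThreeSpokes` BY NAME): for every wheel
representation `r` and every `6ζ(3)` simplex representation `r'` as quantified in the crux,
`KZ.Equivalent r r'`. Bookkeeping in the free abelian group: `[r] ≡ [s₅] ≡ [d₅] ≡ [b₅] ≡ [r₄] ≡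
2[p] ≡ 2[q] ≡ 2([e] + [f]) ≡ 2([E_dih] + [F_dih]) ≡ 2(([E₁] − [E₂]) + ([Z] + [Z'])) ≡
2((2[Z'] − [Z']) + [Z] + [Z']) = 2[Z] + 4[Z'] ≡ 6[Z] ≡ [r']` (duality `[Z'] ≡ [Z]` four times). -/
theorem WheelThreeSpokes_of : WheelThreeSpokes := by
  intro r r' h1 h2 h3 h4
  -- the two word representations and duality
  obtain ⟨Z, hZd, hZi⟩ := exists_zeta3Word_rep
  obtain ⟨Z', hZ'd, hZ'i⟩ := exists_zeta21Word_rep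
  have hZi' : EqOn Z.integrand (fun t => 1 / (t 0 * t 1 * (1 - t 2))) Z.domain := by
    rw [hZi]; exact fun _ _ => rfl
  have hZ'i' : EqOn Z'.integrand (fun t => 1 / (t 0 * (1 - t 1) * (1 - t 2))) Z'.domain := by
    rw [hZ'i]; exact fun _ _ => rfl
  have hdual : KZ.of Z' - KZ.of Z ∈ KZ.relations :=
    zeta21Word_sub_zeta3Word_mem_relations Z Z' hZd hZi' hZ'd hZ'i'
  -- the endgame, backwards: E₁, E₂, E_dih, F_dih, E, F
  obtain ⟨hW1, hW2, hW3, hW4⟩ := stub_wordCharts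
  obtain ⟨e₁, he₁d, he₁i⟩ := hW1 Z' hZ'd hZ'i'
  have he₁i' : EqOn e₁.integrand (fun t => 1 / (t 0 * (t 0 - t 2) * (1 - t 1))) e₁.domain := by
    rw [he₁i]; exact fun _ _ => rfl
  have he₁rel := hW2 e₁ Z' he₁d he₁i' hZ'd hZ'i'
  obtain ⟨e₂, he₂d, he₂i⟩ := hW3 Z' hZ'd hZ'i'
  have he₂i' : EqOn e₂.integrand (fun t => t 2 / (t 0 * (t 0 - t 2) * (1 - t 2) * t 1)) e₂.domain := by
    rw [he₂i]; exact fun _ _ => rfl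
  have he₂rel := hW4 e₂ Z' he₂d he₂i' hZ'd hZ'i'
  obtain ⟨ed, hedd, hedi, hedrel⟩ := stub_eSplit e₁ e₂ he₁d he₁i' he₂d he₂i'
  have hedi' : EqOn ed.integrand
      (fun t => (t 1 - t 2) / (t 0 * (t 0 - t 2) * (1 - t 2) * (1 - t 1) * t 1)) ed.domain := by
    rw [hedi]; exact fun _ _ => rfl
  obtain ⟨fd, hfdd, hfdi, hfdrel⟩ := stub_fSplit Z Z' hZd hZi' hZ'd hZ'i'
  have hfdi' : EqOn fd.integrand (fun t => 1 / (t 0 * t 1 * (1 - t 1) * (1 - t 2))) fd.domain := by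
    rw [hfdi]; exact fun _ _ => rfl
  obtain ⟨hD1, hD2, hD3, hD4⟩ := stub_dihedralCharts
  obtain ⟨e, hed, hei⟩ := hD1 ed hedd hedi'
  have hei' : EqOn e.integrand
      (fun e => (e 2 - e 0) / (e 0 * (1 - e 0) * (1 - e 2) * (1 - e 0 - e 1) * e 2)) e.domain := by
    rw [hei]; exact fun _ _ => rfl
  have herel : KZ.of e - KZ.of ed ∈ KZ.relations := hD2 e ed hed hei' hedd hedi'
  obtain ⟨f, hfd, hfi⟩ := hD3 fd hfdd hfdi'
  have hfi' : EqOn f.integrand (fun f => 1 / ((1 - f 0) * f 1 * f 2)) f.domain := by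
    rw [hfi]; exact fun _ _ => rfl
  have hfrel : KZ.of f - KZ.of fd ∈ KZ.relations := hD4 f fd hfd hfi' hfdd hfdi'
  -- the descent 4 → 3 and Möbius storage, backwards: Q, P2, D4
  obtain ⟨hU1, hU2⟩ := stub_unipotentDescent
  obtain ⟨q, hqd, hqi⟩ := hU1 e f hed hei' hfd hfi'
  have hqi' : EqOn q.integrand (fun q => 1 / (q 1 * (1 - q 0 - q 1) * q 2)) q.domain := by
    rw [hqi]; exact fun _ _ => rfl
  have hqrel := hU2 q e f hqd hqi' hed hei' hfd hfi'
  obtain ⟨hM1, hM2⟩ := stub_moebius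
  obtain ⟨p, hpd, hpi⟩ := hM1 q hqd hqi'
  have hpi' : EqOn p.integrand
      (fun p => 1 / (p 3 * (p 1 * (1 - p 0 - p 1) + p 2 * (1 - p 2) * p 3))) p.domain := by
    rw [hpi]; exact fun _ _ => rfl
  have hprel := hM2 p q hpd hpi' hqd hqi'
  obtain ⟨hC1, hC2⟩ := stub_doubling
  obtain ⟨r₄, hr₄d, hr₄i⟩ := hC1 p hpd hpi'
  have hr₄i' : EqOn r₄.integrand
      (fun p => 1 / (p 3 * (p 1 * (1 - p 0 - p 1) + p 2 * (1 - p 2) * p 3))) r₄.domain := by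
    rw [hr₄i]; exact fun _ _ => rfl
  have hr₄rel := hC2 r₄ p hr₄d hr₄i' hpd hpi'
  -- the charts, forwards from the wheel: Z5, D5, D5T
  obtain ⟨hA1, hA2⟩ := stub_dehomogenise
  obtain ⟨s₅, hs₅d, hs₅i⟩ := hA1 r h1 h2
  have hs₅i' : EqOn s₅.integrand (fun z => 1 / ((z 0 + z 2 + z 3) * (z 1 + z 2 + z 4) - z 2 ^ 2 -
      z 0 ^ 2 * (z 1 + z 2 + z 4) - 2 * z 0 * z 1 * z 2 - z 1 ^ 2 * (z 0 + z 2 + z 3)) ^ 2)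
      s₅.domain := by
    rw [hs₅i]; exact fun _ _ => rfl
  have hs₅rel : KZ.of s₅ - KZ.of r ∈ KZ.relations := hA2 s₅ r hs₅d hs₅i' h1 h2
  obtain ⟨hL1, hL2⟩ := stub_ldlChart
  obtain ⟨d₅, hd₅d, hd₅i⟩ := hL1 s₅ hs₅d hs₅i'
  have hd₅i' : EqOn d₅.integrand (fun y => 1 / (y 3 * y 4 ^ 2)) d₅.domain := by
    rw [hd₅i]; exact fun _ _ => rfl
  have hd₅rel : KZ.of d₅ - KZ.of s₅ ∈ KZ.relations := hL2 d₅ s₅ hd₅d hd₅i' hs₅d hs₅i'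
  obtain ⟨hT1, hT2⟩ := stub_tailChart
  obtain ⟨b₅, hb₅d, hb₅i⟩ := hT1 d₅ hd₅d hd₅i'
  have hb₅i' : EqOn b₅.integrand
      (fun y => 1 / (y 3 * (y 1 * (1 - y 0 - y 1) + y 2 * (1 - y 2) * y 3))) b₅.domain := by
    rw [hb₅i]; exact fun _ _ => rfl
  have hb₅rel : KZ.of b₅ - KZ.of d₅ ∈ KZ.relations := hT2 b₅ d₅ hb₅d hb₅i' hd₅d hd₅i'
  -- Newton–Leibniz 5 → 4
  have hnl : KZ.of b₅ - KZ.of r₄ ∈ KZ.relations := stub_nlFiveFour b₅ r₄ hb₅d hb₅i' hr₄d hr₄i'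
  -- the target side: [r'] ≡ 6 [Z]
  have hr' : KZ.of r' - 6 • KZ.of Z ∈ KZ.relations := by
    refine of_sub_nsmul_of_mem_relations 6 r' Z (by rw [hZd, h3]) fun t ht => ?_
    rw [h4 ht, hZi]
    push_cast
    ring
  -- bookkeeping
  unfold KZ.Equivalent
  have key : KZ.of r - KZ.of r' =
      -(KZ.of s₅ - KZ.of r) - (KZ.of d₅ - KZ.of s₅) - (KZ.of b₅ - KZ.of d₅) + (KZ.of b₅ - KZ.of r₄) +
      (KZ.of r₄ - 2 • KZ.of p) + 2 • (KZ.of p - KZ.of q) + 2 • (KZ.of q - KZ.of e - KZ.of f) +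
      2 • (KZ.of e - KZ.of ed) + 2 • (KZ.of f - KZ.of fd) +
      2 • (KZ.of ed - KZ.of e₁ + KZ.of e₂) + 2 • (KZ.of fd - KZ.of Z - KZ.of Z') +
      2 • (KZ.of e₁ - 2 • KZ.of Z') - 2 • (KZ.of e₂ - KZ.of Z') + 4 • (KZ.of Z' - KZ.of Z) -
      (KZ.of r' - 6 • KZ.of Z) := by
    abel
  rw [key]
  exact sub_mem (add_mem (sub_mem (add_mem (add_mem (add_mem (add_mem (add_mem (add_mem (add_mem
    (add_mem (add_mem (sub_mem (sub_mem (neg_mem hs₅rel) hd₅rel) hb₅rel) hnl) hr₄rel) (nsmul_mem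
    hprel 2)) (nsmul_mem hqrel 2)) (nsmul_mem herel 2)) (nsmul_mem hfrel 2)) (nsmul_mem hedrel 2))
    (nsmul_mem hfdrel 2)) (nsmul_mem he₁rel 2)) (nsmul_mem he₂rel 2)) (nsmul_mem hdual 4)) hr'

/-- **The same crux as filed by route SiegelTamagawa** (`SiegelTamagawa.WheelThreeSpokes`, the
identical statement; item stmt-KontsevichZagierPeriods-3913 is shared by the two routes): the wheel
with three spokes is KZ-equivalent to the `6ζ(3)` simplex representation. -/
theorem WheelThreeSpokes_of_siegelTamagawa :
    Summit.KontsevichZagierPeriods.KontsevichZagierPeriods.Theses.SiegelTamagawa.WheelThreeSpokes :=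
  WheelThreeSpokes_of

end Summit.KontsevichZagierPeriods.LinRedNormalForm.WheelThreeSpokes
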